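import Summits.ValiantsHypothesis.ValiantsHypothesis.Theorems.LacunarySymmetroidMatrixDescartesChainLaw

/-!
# `MatrixDescartes` census — THE CHAIN LADDER `ζ_sym(m, 3j+1) ≥ j·(m² + 2m)` and congruent junctions

HONEST FRAMING.  Object-search cell `pub-symmetroid`, crux `Theses.LacunarySymmetroid.MatrixDescartes`
(stmt-ValiantsHypothesis-18050); seat val-sym-mdr-p1 (g8).  LOWER-bound / construction mathematics in census (CONJECTURE-A)
currency; it proves NOTHING about the crux `MatrixDescartes` (an UPPER-bound statement at fat formats), nothing about
`DoorA26` / `DoorA34`, nothing about `VP ≠ VNP`.  No definitions.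

* LADDER (`exists_alternating_ladder`): alternating the junction law (`Chain.exists_alternating_junction`) between a strictly supported
  certificate `F` (`K+1` letters, `N` alternations, bottom letter `S 0`, top letter `S last`) and its reversal `F♯` (bottom `S last`, top
  `S 0`) builds, for every `j`, TWO certificates with `(j+1)K + 1` letters and `(j+1)N` alternations — `A_j` with bottom letter `S 0` and
  `B_j` with bottom letter `S last` (`A_{j+1} = F ▹ B_j`, `B_{j+1} = F♯ ▹ A_j`; the bottom letter of a junction is the bottom letter of its
  first block, which is kept verbatim).  Rows: **`ζ_sym(m, 3(j+1)+1) ≥ (j+1)(m² + 2m)`** for every `m ≥ 1`, `j ≥ 0`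
  (`not_posRootLawAt_ladder`; conjb-1 g6's paper chain «`ζ_sym(m,3j+1) ≥ j(m²+2m)`», ROUND-6 memo §3), and with `i` grafted letters
  **`ζ_sym(m, 3(j+1)+1+i) ≥ (j+1)(m²+2m) + i·m`** (`not_posRootLawAt_ladder_add`) — for a fixed `K ≥ 4` the best split is
  `j+1 = ⌊(K−1)/3⌋`, `i = (K−1) mod 3`: the quadratic coefficient of the kernel floor grows linearly in `K`.
* CONGRUENT JUNCTIONS (`alternating_congr`, `exists_alternating_junction_congr`): certificates are invariant under a congruence
  `S l ↦ Cᵀ S l C` (`det C ≠ 0`), so the junction law needs the junction letters only up to congruence («matching junction inertia»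
  for nonsingular letters, by Sylvester's law — not used here).
[folklore] throughout.
-/

-- `Summit.ValiantsHypothesis.ValiantsHypothesis.…` repeats a component by the D-0017 layout
-- (single-conjunct summit), which the `dupNamespace` linter flags; the name is mandated.
set_option linter.dupNamespace false

namespace Summit.ValiantsHypothesis.ValiantsHypothesis.Theorems.LacunarySymmetroidMatrixDescartes.Census.Chain

open Matrix Finset Filter Topology
open scoped BigOperators
open Summit.ValiantsHypothesis.ValiantsHypothesis.Theorems.LacunarySymmetroidMatrixDescartes.Census.Graft
open Summit.ValiantsHypothesis.ValiantsHypothesis.Theorems.MatrixDescartes.Negative (PosRootLawAt)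

/-! ### Certificates with a prescribed bottom letter -/

/-- Transport of a strictly supported certificate WITH PRESCRIBED BOTTOM LETTER along equalities of the letter count and of the
alternation count (bookkeeping). [folklore] -/
theorem certificateB_transport {m n n' N N' : ℕ} {B : Matrix (Fin m) (Fin m) ℝ} (hn : n = n') (hN : N = N')
    (h : ∃ (d : Fin n → ℕ) (S : Fin n → Matrix (Fin m) (Fin m) ℝ) (τ : Fin (N + 1) → ℝ),
      StrictMono d ∧ (∀ h0 : 0 < n, S ⟨0, h0⟩ = B) ∧ (∀ l, (S l).IsSymm) ∧ StrictMono τ ∧ (∀ j, 0 < τ j) ∧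
      (∀ j, (∑ l, τ j ^ d l • S l).det ≠ 0) ∧
      ∀ j : Fin N, (∑ l, τ j.castSucc ^ d l • S l).det * (∑ l, τ j.succ ^ d l • S l).det < 0) :
    ∃ (d : Fin n' → ℕ) (S : Fin n' → Matrix (Fin m) (Fin m) ℝ) (τ : Fin (N' + 1) → ℝ),
      StrictMono d ∧ (∀ h0 : 0 < n', S ⟨0, h0⟩ = B) ∧ (∀ l, (S l).IsSymm) ∧ StrictMono τ ∧ (∀ j, 0 < τ j) ∧
      (∀ j, (∑ l, τ j ^ d l • S l).det ≠ 0) ∧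
      ∀ j : Fin N', (∑ l, τ j.castSucc ^ d l • S l).det * (∑ l, τ j.succ ^ d l • S l).det < 0 := by
  subst hn hN
  exact h

/-- **Junction step with bottom-letter bookkeeping.**  An explicit strictly supported certificate `P` (`K₁+1` letters, `N₁`
alternations) followed by ANY strictly supported certificate with `K₂+1` letters and `N₂` alternations whose bottom letter is the top
letter `S last` of `P` gives a strictly supported certificate with `K₁ + K₂ + 1` letters, `N₁ + N₂` alternations and bottom letter
`S 0` (`Chain.exists_alternating_junction`, re-indexed). [folklore] -/
theorem exists_alternating_junctionB {m K₁ K₂ N₁ N₂ : ℕ}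
    (d : Fin (K₁ + 1) → ℕ) (S : Fin (K₁ + 1) → Matrix (Fin m) (Fin m) ℝ) (hd : StrictMono d)
    (hS : ∀ l, (S l).IsSymm) (τ : Fin (N₁ + 1) → ℝ) (hτ : StrictMono τ) (hτpos : ∀ j, 0 < τ j)
    (hne : ∀ j, (∑ l, τ j ^ d l • S l).det ≠ 0)
    (halt : ∀ j : Fin N₁, (∑ l, τ j.castSucc ^ d l • S l).det * (∑ l, τ j.succ ^ d l • S l).det < 0)
    (hQ : ∃ (e : Fin (K₂ + 1) → ℕ) (T : Fin (K₂ + 1) → Matrix (Fin m) (Fin m) ℝ) (σ : Fin (N₂ + 1) → ℝ),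
      StrictMono e ∧ (∀ h0 : 0 < K₂ + 1, T ⟨0, h0⟩ = S (Fin.last K₁)) ∧ (∀ l, (T l).IsSymm) ∧ StrictMono σ ∧
      (∀ j, 0 < σ j) ∧ (∀ j, (∑ l, σ j ^ e l • T l).det ≠ 0) ∧
      ∀ j : Fin N₂, (∑ l, σ j.castSucc ^ e l • T l).det * (∑ l, σ j.succ ^ e l • T l).det < 0) :
    ∃ (d' : Fin (K₁ + K₂ + 1) → ℕ) (S' : Fin (K₁ + K₂ + 1) → Matrix (Fin m) (Fin m) ℝ) (τ' : Fin (N₁ + N₂ + 1) → ℝ),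
      StrictMono d' ∧ (∀ h0 : 0 < K₁ + K₂ + 1, S' ⟨0, h0⟩ = S 0) ∧ (∀ l, (S' l).IsSymm) ∧ StrictMono τ' ∧
      (∀ j, 0 < τ' j) ∧ (∀ j, (∑ l, τ' j ^ d' l • S' l).det ≠ 0) ∧
      ∀ j : Fin (N₁ + N₂), (∑ l, τ' j.castSucc ^ d' l • S' l).det * (∑ l, τ' j.succ ^ d' l • S' l).det < 0 := by
  obtain ⟨e, T, σ, he, hT0, hT, hσ, hσpos, hne', halt'⟩ := hQ
  have hJ : T 0 = S (Fin.last K₁) := hT0 (Nat.succ_pos K₂)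
  obtain ⟨d', S', τ', hd', hold, -, hS', hτ', hpos', hne'', halt''⟩ :=
    exists_alternating_junction d S hd hS τ hτ hτpos hne halt e T he hT σ hσ hσpos hne' halt' hJ
  refine certificateB_transport (n := K₁ + 1 + K₂) (by omega) rfl
    ⟨d', S', τ', hd', fun h0 => ?_, hS', hτ', hpos', hne'', halt''⟩
  have h0' : (⟨0, h0⟩ : Fin (K₁ + 1 + K₂)) = Fin.castAdd K₂ 0 := Fin.ext rfl
  rw [h0']
  exact (hold 0).2

/-! ### The ladder -/

/-- **THE CHAIN LADDER (all formats).**  From ONE strictly supported alternation certificate `F = (d, S, τ)` with `K+1` letters and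
`N` alternations, for every `j` there are strictly supported certificates with `(j+1)·K + 1` letters and `(j+1)·N` alternations —
one with bottom letter `S 0` and one with bottom letter `S last` — obtained by alternately chaining `F` and its reversal `F♯` through the
shared end letters (`A₀ = F`, `B₀ = F♯`, `A_{j+1} = F ▹ B_j`, `B_{j+1} = F♯ ▹ A_j`).  In census words
`ζ_sym(m, (j+1)K + 1) ≥ (j+1)·ζ_alt(F)`. [folklore] -/
theorem exists_alternating_ladder {m K N : ℕ} (d : Fin (K + 1) → ℕ) (S : Fin (K + 1) → Matrix (Fin m) (Fin m) ℝ)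
    (hd : StrictMono d) (hS : ∀ l, (S l).IsSymm) (τ : Fin (N + 1) → ℝ) (hτ : StrictMono τ) (hpos : ∀ j, 0 < τ j)
    (hne : ∀ j, (∑ l, τ j ^ d l • S l).det ≠ 0)
    (halt : ∀ j : Fin N, (∑ l, τ j.castSucc ^ d l • S l).det * (∑ l, τ j.succ ^ d l • S l).det < 0) (j : ℕ) :
    (∃ (d' : Fin ((j + 1) * K + 1) → ℕ) (S' : Fin ((j + 1) * K + 1) → Matrix (Fin m) (Fin m) ℝ)
        (τ' : Fin ((j + 1) * N + 1) → ℝ),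
      StrictMono d' ∧ (∀ h0 : 0 < (j + 1) * K + 1, S' ⟨0, h0⟩ = S 0) ∧ (∀ l, (S' l).IsSymm) ∧ StrictMono τ' ∧
      (∀ i, 0 < τ' i) ∧ (∀ i, (∑ l, τ' i ^ d' l • S' l).det ≠ 0) ∧
      ∀ i : Fin ((j + 1) * N), (∑ l, τ' i.castSucc ^ d' l • S' l).det * (∑ l, τ' i.succ ^ d' l • S' l).det < 0) ∧
    (∃ (d' : Fin ((j + 1) * K + 1) → ℕ) (S' : Fin ((j + 1) * K + 1) → Matrix (Fin m) (Fin m) ℝ)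
        (τ' : Fin ((j + 1) * N + 1) → ℝ),
      StrictMono d' ∧ (∀ h0 : 0 < (j + 1) * K + 1, S' ⟨0, h0⟩ = S (Fin.last K)) ∧ (∀ l, (S' l).IsSymm) ∧
      StrictMono τ' ∧ (∀ i, 0 < τ' i) ∧ (∀ i, (∑ l, τ' i ^ d' l • S' l).det ≠ 0) ∧
      ∀ i : Fin ((j + 1) * N), (∑ l, τ' i.castSucc ^ d' l • S' l).det * (∑ l, τ' i.succ ^ d' l • S' l).det < 0) := by
  obtain ⟨e, T, σ, -, hT', -, he, hT, hσ, hσpos, hne', halt'⟩ :=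
    exists_alternating_reverse d S hd hS τ hτ hpos hne halt
  have hT0 : T 0 = S (Fin.last K) := by rw [hT', Fin.rev_zero]
  have hTl : T (Fin.last K) = S 0 := by rw [hT', Fin.rev_last]
  induction j with
  | zero =>
    exact ⟨certificateB_transport (by ring) (by ring) ⟨d, S, τ, hd, fun _ => rfl, hS, hτ, hpos, hne, halt⟩,
      certificateB_transport (by ring) (by ring) ⟨e, T, σ, he, fun _ => hT0, hT, hσ, hσpos, hne', halt'⟩⟩
  | succ j ih =>
    obtain ⟨hA, hB⟩ := ih
    refine ⟨?_, ?_⟩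
    · -- `A_{j+1} = F ▹ B_j`
      exact certificateB_transport (by ring) (by ring) (exists_alternating_junctionB d S hd hS τ hτ hpos hne halt hB)
    · -- `B_{j+1} = F♯ ▹ A_j`
      obtain ⟨da, Sa, τa, hda, hSa0, hSa, hτa, hposa, hnea, halta⟩ := hA
      have hA' : ∃ (d' : Fin ((j + 1) * K + 1) → ℕ) (S' : Fin ((j + 1) * K + 1) → Matrix (Fin m) (Fin m) ℝ)
          (τ' : Fin ((j + 1) * N + 1) → ℝ),
          StrictMono d' ∧ (∀ h0 : 0 < (j + 1) * K + 1, S' ⟨0, h0⟩ = T (Fin.last K)) ∧ (∀ l, (S' l).IsSymm) ∧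
          StrictMono τ' ∧ (∀ i, 0 < τ' i) ∧ (∀ i, (∑ l, τ' i ^ d' l • S' l).det ≠ 0) ∧
          ∀ i : Fin ((j + 1) * N), (∑ l, τ' i.castSucc ^ d' l • S' l).det * (∑ l, τ' i.succ ^ d' l • S' l).det < 0 :=
        ⟨da, Sa, τa, hda, fun h0 => (hSa0 h0).trans hTl.symm, hSa, hτa, hposa, hnea, halta⟩
      have h := exists_alternating_junctionB e T he hT σ hσ hσpos hne' halt' hA'
      rw [hT0] at h
      exact certificateB_transport (by ring) (by ring) h

/-! ### Rows -/

/-- **Certificate ⇒ laddered and grafted certificate (for the census generator).**  ANY alternation certificate with `K+1` letters (any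
support) and `N` alternations at size `m` yields, for all `j, i`, a certificate with `(j+1)K + 1 + i` letters and `(j+1)N + i·m`
alternations (support normal form `Graft.exists_alternating_strictMono`, the ladder, then `i` grafted letters by `Graft.exists_alternating_add`).
[folklore] -/
theorem exists_alternating_ladder_add {m K N : ℕ} (d : Fin (K + 1) → ℕ) (S : Fin (K + 1) → Matrix (Fin m) (Fin m) ℝ)
    (hS : ∀ l, (S l).IsSymm) (τ : Fin (N + 1) → ℝ) (hτ : StrictMono τ) (hpos : ∀ j, 0 < τ j)
    (hne : ∀ j, (∑ l, τ j ^ d l • S l).det ≠ 0)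
    (halt : ∀ j : Fin N, (∑ l, τ j.castSucc ^ d l • S l).det * (∑ l, τ j.succ ^ d l • S l).det < 0) (j i : ℕ) :
    ∃ (d' : Fin ((j + 1) * K + 1 + i) → ℕ) (S' : Fin ((j + 1) * K + 1 + i) → Matrix (Fin m) (Fin m) ℝ)
      (τ' : Fin ((j + 1) * N + i * m + 1) → ℝ),
      (∀ l, (S' l).IsSymm) ∧ StrictMono τ' ∧ (∀ r, 0 < τ' r) ∧ (∀ r, (∑ l, τ' r ^ d' l • S' l).det ≠ 0) ∧
      ∀ r : Fin ((j + 1) * N + i * m), (∑ l, τ' r.castSucc ^ d' l • S' l).det * (∑ l, τ' r.succ ^ d' l • S' l).det < 0 := by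
  obtain ⟨d₁, S₁, hd₁, hS₁, hne₁, halt₁⟩ := exists_alternating_strictMono d S hS τ hpos hne halt
  obtain ⟨⟨d', S', τ', -, -, hS', hτ', hpos', hne', halt'⟩, -⟩ :=
    exists_alternating_ladder d₁ S₁ hd₁ hS₁ τ hτ hpos hne₁ halt₁ j
  exact exists_alternating_add ⟨d', S', τ', hS', hτ', hpos', hne', halt'⟩ i

/-- **Certificate ⇒ chain-ladder rows (for the census generator).**  Same hypotheses as the tree's `Census.not_posRootLawAt_of_certificate`
(closed form `q` of `det F(t)`, symmetric letters, strictly increasing positive test points, strict sign alternation of `q`, `N ≥ 1`) —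
conclusion for EVERY `j, i`: `¬ PosRootLawAt m ((j+1)K + 1 + i) ((j+1)N + i·m − 1)` for a certificate with `K+1` letters: a census
certificate file obtains its chained-and-grafted rows by replacing the final lemma (`j = 0` is g3's `Graft.not_posRootLawAt_add_of_certificate`).
[folklore] -/
theorem not_posRootLawAt_ladder_add_of_certificate {m K N : ℕ} {d : Fin (K + 1) → ℕ}
    {S : Fin (K + 1) → Matrix (Fin m) (Fin m) ℝ} {q : ℝ → ℝ}
    (hq : ∀ t : ℝ, (∑ l, t ^ d l • S l).det = q t) (hS : ∀ l, (S l).IsSymm)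
    (τ : Fin (N + 1) → ℝ) (hτ : StrictMono τ) (hpos : ∀ j, 0 < τ j)
    (halt : ∀ j : Fin N, q (τ j.castSucc) * q (τ j.succ) < 0) (hN : 1 ≤ N) (j i : ℕ) :
    ¬ PosRootLawAt m ((j + 1) * K + 1 + i) ((j + 1) * N + i * m - 1) := by
  have halt' : ∀ i : Fin N,
      (∑ l, τ i.castSucc ^ d l • S l).det * (∑ l, τ i.succ ^ d l • S l).det < 0 := fun i => by
    rw [hq, hq]; exact halt i
  have hne : ∀ i, (∑ l, τ i ^ d l • S l).det ≠ 0 :=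
    ne_zero_of_alternating hN (fun i => (∑ l, τ i ^ d l • S l).det) halt'
  obtain ⟨d', S', τ', hS', hτ', hpos', -, halt''⟩ := exists_alternating_ladder_add d S hS τ hτ hpos hne halt' j i
  have hN' : 1 ≤ (j + 1) * N + i * m := le_trans (le_trans hN (Nat.le_mul_of_pos_left _ (Nat.succ_pos j))) (Nat.le_add_right _ _)
  exact not_posRootLawAt_of_alternating hN' d' S' hS' τ' hτ' hpos' halt''

/-- **THE CHAIN LADDER ROWS: `ζ_sym(m, 3(j+1)+1) ≥ (j+1)(m² + 2m)` for every `m ≥ 1`, `j ≥ 0`** —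
`¬ PosRootLawAt m (3(j+1)+1) ((j+1)((m+1)² − 1) − 1)` (the `K = 4` base `Graft.exists_alternating_four` on its strictly increasing support,
laddered `j` times; `j = 0` is P4 `m² + 2m`, `j = 1` is `not_posRootLawAt_seven`, `j = 2` reads `ζ_sym(m,10) ≥ 3m² + 6m`).  A LOWER
bound in census currency — nothing about the crux `MatrixDescartes`. [folklore] -/
theorem not_posRootLawAt_ladder (m j : ℕ) (hm : 1 ≤ m) :
    ¬ PosRootLawAt m (3 * (j + 1) + 1) ((j + 1) * ((m + 1) ^ 2 - 1) - 1) := by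
  obtain ⟨d, S, τ, hS, hτ, hpos, hne, halt⟩ := exists_alternating_four m hm
  have hsq : 1 ≤ (m + 1) ^ 2 - 1 := by
    have : 4 ≤ (m + 1) ^ 2 := by nlinarith
    omega
  obtain ⟨d₁, S₁, hd₁, hS₁, hne₁, halt₁⟩ := exists_alternating_strictMono d S hS τ hpos hne halt
  obtain ⟨⟨d', S', τ', -, -, hS', hτ', hpos', -, halt'⟩, -⟩ :=
    exists_alternating_ladder d₁ S₁ hd₁ hS₁ τ hτ hpos hne₁ halt₁ j
  have hN : 1 ≤ (j + 1) * ((m + 1) ^ 2 - 1) := le_trans hsq (Nat.le_mul_of_pos_left _ (Nat.succ_pos j))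
  have h := not_posRootLawAt_of_alternating hN d' S' hS' τ' hτ' hpos' halt'
  rw [show (j + 1) * 3 + 1 = 3 * (j + 1) + 1 by ring] at h
  exact h

/-- **THE CHAIN LADDER ROWS, grafted: `ζ_sym(m, 3(j+1)+1+i) ≥ (j+1)(m² + 2m) + i·m` for every `m ≥ 1`, `j, i ≥ 0`** —
`¬ PosRootLawAt m (3(j+1)+1+i) ((j+1)((m+1)² − 1) + i·m − 1)` (ladder `j` times, then `i` grafted letters by `Graft.exists_alternating_add`).
For a fixed `K ≥ 4` the best split is `j+1 = ⌊(K−1)/3⌋`, `i = (K−1) mod 3`. [folklore] -/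
theorem not_posRootLawAt_ladder_add (m j i : ℕ) (hm : 1 ≤ m) :
    ¬ PosRootLawAt m (3 * (j + 1) + 1 + i) ((j + 1) * ((m + 1) ^ 2 - 1) + i * m - 1) := by
  obtain ⟨d, S, τ, hS, hτ, hpos, hne, halt⟩ := exists_alternating_four m hm
  have hsq : 1 ≤ (m + 1) ^ 2 - 1 := by
    have : 4 ≤ (m + 1) ^ 2 := by nlinarith
    omega
  obtain ⟨d'', S'', τ'', hS'', hτ'', hpos'', -, halt''⟩ := exists_alternating_ladder_add d S hS τ hτ hpos hne halt j i
  have hN : 1 ≤ (j + 1) * ((m + 1) ^ 2 - 1) + i * m :=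
    le_trans (le_trans hsq (Nat.le_mul_of_pos_left _ (Nat.succ_pos j))) (Nat.le_add_right _ _)
  have h := not_posRootLawAt_of_alternating hN d'' S'' hS'' τ'' hτ'' hpos'' halt''
  rw [show (j + 1) * 3 + 1 + i = 3 * (j + 1) + 1 + i by ring] at h
  exact h

/-! ### Numeral rows (census format `(m,K) ≥ B + 1` reads `¬ PosRootLawAt m K B`; sizes without census certificates) -/

/-- `ζ_sym(6,10) ≥ 144`. [folklore] -/
theorem row_6_10 : ¬ PosRootLawAt 6 10 143 := not_posRootLawAt_ladder 6 2 (by norm_num)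

/-- `ζ_sym(7,10) ≥ 189`. [folklore] -/
theorem row_7_10 : ¬ PosRootLawAt 7 10 188 := not_posRootLawAt_ladder 7 2 (by norm_num)

/-- `ζ_sym(8,10) ≥ 240`. [folklore] -/
theorem row_8_10 : ¬ PosRootLawAt 8 10 239 := not_posRootLawAt_ladder 8 2 (by norm_num)

/-- `ζ_sym(6,11) ≥ 150`. [folklore] -/
theorem row_6_11 : ¬ PosRootLawAt 6 11 149 := not_posRootLawAt_ladder_add 6 2 1 (by norm_num)

/-- `ζ_sym(6,16) ≥ 240`. [folklore] -/
theorem row_6_16 : ¬ PosRootLawAt 6 16 239 := not_posRootLawAt_ladder 6 4 (by norm_num)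

/-! ### Congruent junction letters -/

/-- **Certificates are congruence invariant**: replacing every letter `S l` by `Cᵀ S l C` with `det C ≠ 0` multiplies every evaluated
determinant by `(det C)² > 0`, so nonvanishing and alternation persist (and symmetry is kept). [folklore] -/
theorem alternating_congr {m K N : ℕ} (d : Fin K → ℕ) (S : Fin K → Matrix (Fin m) (Fin m) ℝ) (hS : ∀ l, (S l).IsSymm)
    (C : Matrix (Fin m) (Fin m) ℝ) (hC : C.det ≠ 0) (τ : Fin (N + 1) → ℝ)
    (hne : ∀ j, (∑ l, τ j ^ d l • S l).det ≠ 0)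
    (halt : ∀ j : Fin N, (∑ l, τ j.castSucc ^ d l • S l).det * (∑ l, τ j.succ ^ d l • S l).det < 0) :
    (∀ l, (Cᵀ * S l * C).IsSymm) ∧ (∀ j, (∑ l, τ j ^ d l • (Cᵀ * S l * C)).det ≠ 0) ∧
      ∀ j : Fin N, (∑ l, τ j.castSucc ^ d l • (Cᵀ * S l * C)).det *
        (∑ l, τ j.succ ^ d l • (Cᵀ * S l * C)).det < 0 := by
  have hdet : ∀ y : ℝ, (∑ l, y ^ d l • (Cᵀ * S l * C)).det = C.det ^ 2 * (∑ l, y ^ d l • S l).det := by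
    intro y
    rw [← transpose_mul_sum_smul_mul C (fun l => y ^ d l) S, det_mul, det_mul, det_transpose]
    ring
  have hC2 : 0 < C.det ^ 2 := by positivity
  refine ⟨fun l => isSymm_transpose_mul_mul C (hS l), fun j => ?_, fun j => ?_⟩
  · rw [hdet]
    exact mul_ne_zero (pow_ne_zero _ hC) (hne j)
  · rw [hdet, hdet]
    have h := halt j
    have hrw : C.det ^ 2 * (∑ l, τ j.castSucc ^ d l • S l).det * (C.det ^ 2 * (∑ l, τ j.succ ^ d l • S l).det)
        = (C.det ^ 2 * C.det ^ 2) *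
          ((∑ l, τ j.castSucc ^ d l • S l).det * (∑ l, τ j.succ ^ d l • S l).det) := by ring
    rw [hrw]
    exact mul_neg_of_pos_of_neg (mul_pos hC2 hC2) h

/-- **THE JUNCTION LAW for CONGRUENT junction letters.**  As `Chain.exists_alternating_junction`, but the bottom letter of the second
certificate need only be CONGRUENT to the top letter of the first: `T 0 = Cᵀ S last C` with `det C ≠ 0` (the first certificate is moved
by the congruence, then chained).  Conclusion: a strictly supported certificate with `K₁ + 1 + K₂` letters and `N₁ + N₂` alternations —
`ζ_sym(m, K₁+K₂+1) ≥ ζ_alt(P) + ζ_alt(Q)` for congruent junction letters. [folklore] -/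
theorem exists_alternating_junction_congr {m K₁ K₂ N₁ N₂ : ℕ}
    (d : Fin (K₁ + 1) → ℕ) (S : Fin (K₁ + 1) → Matrix (Fin m) (Fin m) ℝ) (hd : StrictMono d)
    (hS : ∀ l, (S l).IsSymm) (τ : Fin (N₁ + 1) → ℝ) (hτ : StrictMono τ) (hτpos : ∀ j, 0 < τ j)
    (hne : ∀ j, (∑ l, τ j ^ d l • S l).det ≠ 0)
    (halt : ∀ j : Fin N₁, (∑ l, τ j.castSucc ^ d l • S l).det * (∑ l, τ j.succ ^ d l • S l).det < 0)
    (e : Fin (K₂ + 1) → ℕ) (T : Fin (K₂ + 1) → Matrix (Fin m) (Fin m) ℝ) (he : StrictMono e)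
    (hT : ∀ l, (T l).IsSymm) (σ : Fin (N₂ + 1) → ℝ) (hσ : StrictMono σ) (hσpos : ∀ j, 0 < σ j)
    (hne' : ∀ j, (∑ l, σ j ^ e l • T l).det ≠ 0)
    (halt' : ∀ j : Fin N₂, (∑ l, σ j.castSucc ^ e l • T l).det * (∑ l, σ j.succ ^ e l • T l).det < 0)
    (C : Matrix (Fin m) (Fin m) ℝ) (hC : C.det ≠ 0) (hJ : T 0 = Cᵀ * S (Fin.last K₁) * C) :
    ∃ (d' : Fin (K₁ + 1 + K₂) → ℕ) (S' : Fin (K₁ + 1 + K₂) → Matrix (Fin m) (Fin m) ℝ)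
      (τ' : Fin (N₁ + N₂ + 1) → ℝ),
      StrictMono d' ∧ (∀ l, (S' l).IsSymm) ∧ StrictMono τ' ∧ (∀ j, 0 < τ' j) ∧
      (∀ j, (∑ l, τ' j ^ d' l • S' l).det ≠ 0) ∧
      ∀ j : Fin (N₁ + N₂), (∑ l, τ' j.castSucc ^ d' l • S' l).det * (∑ l, τ' j.succ ^ d' l • S' l).det < 0 := by
  obtain ⟨hS₁, hne₁, halt₁⟩ := alternating_congr d S hS C hC τ hne halt
  obtain ⟨d', S', τ', hd', -, -, hS', hτ', hpos', hne'', halt''⟩ :=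
    exists_alternating_junction d (fun l => Cᵀ * S l * C) hd hS₁ τ hτ hτpos hne₁ halt₁ e T he hT σ hσ hσpos
      hne' halt' hJ
  exact ⟨d', S', τ', hd', hS', hτ', hpos', hne'', halt''⟩

end Summit.ValiantsHypothesis.ValiantsHypothesis.Theorems.LacunarySymmetroidMatrixDescartes.Census.Chain
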